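import Summits.QuantumFields.YangMills.Theorems.DiagonalMirrorRPRCubePairing
import Summits.QuantumFields.YangMills.Theorems.DiagonalMirrorRPRCubeHalfRP
import Summits.QuantumFields.YangMills.Theorems.PencilRigidityWeakCouplingHypercubicLimitRPDiagRPOfSwapPairing

/-!
# Crux `WeakCouplingHypercubicLimitRP` (stmt-QuantumFields-27398), line `Sketch`, stub D1′ `stub_oddTorusSwapPairingLiminf`:
# the DOOR-C COMPOSITION under `Theorems/` — D1′ (and D1) ⟸ the ONE letter `AdmissibleCubeDecoupling` on the witness (sub-)scheme

Helper file (`--supports stmt-QuantumFields-27398 --as helper`) of the crux lead `lead-27398-D1` (gen 2; PICKED.md of record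
`Cruxes/WeakCouplingHypercubicLimitRP/PICKED.md`) for the registered lattice stub D1′ `stub_oddTorusSwapPairingLiminf` of
`Cruxes/WeakCouplingHypercubicLimitRP/Lines/Sketch.lean` (v2, ρ1 reshape); it closes nothing by itself.  It is the door-C twin of hand-2's
door-B composition `…PencilRigidityWeakCouplingHypercubicLimitRPDiagRPOfTwistLetters` (p827816).

WHAT (all by name, no body restated).  Door C (card #114 `cube-surgery-decoupling`) is now kernel-checked end to end below its ONE letter:
* `oddTorusSwapPairingLiminf_of_cubeDecoupling`: `sch.HasWeakCouplingLimit → AdmissibleCubeDecoupling r sch → OddTorusSwapPairingLiminf r sch` —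
  S1a `cubeHalfRP` (the free hypercube inside the own torus is EXACTLY swap-RP, `…DiagonalMirrorRPRCubeHalfRP`) + S1b + `pairingLiminf_of_cubeHalfRP`
  (`…DiagonalMirrorRPRCubePairing`); along `φ`: `oddTorusSwapPairingLiminf_subseq_of_cubeDecoupling`;
* **`stub_oddTorusSwapPairingLiminf_of_cubeDecoupling`**: D1′'s EXACT binder list (`HasWeakCouplingLimit`, `PolyVolume`, `PolyRenorm`,
  `UniformFunctionalBoundPlanes`, `RPSpectral`, `PlaneLimits` — only the first is used by door C's glue) followed by ONE hypothesis
  `AdmissibleCubeDecoupling r (subseq sch φ hφ)` ⇒ D1′'s conclusion `OddTorusSwapPairingLiminf r (subseq sch φ hφ)` BY NAME;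
* `diagRPOfPlaneLimits_of_cubeDecoupling` / `stub_diagRPOfPlaneLimits_of_cubeDecoupling`: the same letter + `UniformFunctionalBoundPlanes` +
  `PlaneLimits r sch φ T` ⇒ D1's conclusion `DiagonalFrameRP (planeSum T)` through the landed transfer `diagRPOfPlaneLimits_of_swapPairingLiminf`
  (lead g0, p827255).

WHAT REMAINS FOR D1′ VIA DOOR C (honest): exactly the letter `AdmissibleCubeDecoupling r (subseq sch φ hφ)` — for some radii `R_k ≤ L_k` with
`a_k R_k → ∞`, the torus-minus-free-cube swap Gram pairing of every pairwise-disjoint reflected family tends to `0` (thermodynamic-limit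
insensitivity of renormalised local curvature pairings to a receding axis-aligned free boundary, in physical units).  It is sign-free and
frame-free, WEAKER IN KIND than a mass gap (massless `U(1)₄` satisfies it), a theorem at strong coupling (Osterwalder–Seiler 1978 §3–4) and for
finite `G` at large `β` (Adhikari–Cao 2022), and NOT proved anywhere for non-abelian `G` at weak coupling; it is NOT derivable from D1′'s binder
`RPSpectral` by soft means (weak ⇏ strong mixing in `d ≥ 3`).  D1′, the crux ⟨27398⟩ and its heart S6i are OPEN; nothing here bears on the summit;
the Yang–Mills mass gap is NOT proved here or anywhere in the tree.  No definition, no instance, no notation, `autoImplicit false`.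

References: Fröhlich–Israel–Lieb–Simon, Comm. Math. Phys. 62 (1978) Thm 2.1; Osterwalder–Seiler, Ann. Phys. 110 (1978) §2–4; Seiler, LNP 159
(1982) Ch. 2; A. Adhikari, S. Cao, arXiv:2202.10375 Thm 1.
-/

set_option autoImplicit false

noncomputable section

open scoped SchwartzMap
open MeasureTheory Filter Topology
open Literature.MathematicalPhysics.QuantumLattice Literature.MathematicalPhysics.AQFT
  Literature.MathematicalPhysics.QuantumFieldTheory
open Summit.QuantumFields.YangMills.Cruxes.HypercubicLimit.CouplingResponse
open Summit.QuantumFields.YangMills.Cruxes.DiagonalMirrorRPR.ParityBridgeColdTraces (E4 DiagonalFrameRP)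
open Summit.QuantumFields.YangMills.Cruxes.DiagonalMirrorRPR.SignTwistedDiagonalTrace
open Summit.QuantumFields.YangMills.Cruxes.DiagonalMirrorRPR.CubeSurgery

namespace Summit.QuantumFields.YangMills.Theorems.WeakCouplingHypercubicLimit.TraceNormColdPressure

section DoorC

variable {G : Type} [Group G] [TopologicalSpace G] [IsTopologicalGroup G] [CompactSpace G]
  [MeasurableSpace G] [BorelSpace G] (r : LatticeRep G) (sch : SpeciesScheme (YMSpecies G))

/-- **Door C on the scheme**: weak coupling and an admissible cube decoupling give the socket `OddTorusSwapPairingLiminf r sch` — the cube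
swap-RP hypothesis of `oddTorusSwapPairingLiminf_of_cubeHalfRP_of_admissible` DISCHARGED by S1a `cubeHalfRP`. -/
theorem oddTorusSwapPairingLiminf_of_cubeDecoupling (hw : sch.HasWeakCouplingLimit) (hdec : AdmissibleCubeDecoupling r sch) :
    OddTorusSwapPairingLiminf r sch :=
  oddTorusSwapPairingLiminf_of_cubeHalfRP_of_admissible r sch cubeHalfRP hw hdec

variable (φ : ℕ → ℕ) (hφ : StrictMono φ)

/-- **Door C along `φ`** (the register of D1′): weak coupling of the SCHEME and an admissible cube decoupling of the SUB-SCHEME give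
`OddTorusSwapPairingLiminf r (subseq sch φ hφ)`. -/
theorem oddTorusSwapPairingLiminf_subseq_of_cubeDecoupling (hw : sch.HasWeakCouplingLimit)
    (hdec : AdmissibleCubeDecoupling r (subseq sch φ hφ)) : OddTorusSwapPairingLiminf r (subseq sch φ hφ) :=
  oddTorusSwapPairingLiminf_subseq_of_cubeHalfRP r sch cubeHalfRP hw φ hφ hdec

/-- **D1 ⟸ door C's letter on the witness sub-scheme.**  For the D1 witness `(subseq sch φ hφ, planeSum T)`: weak coupling,
`UniformFunctionalBoundPlanes`, `PlaneLimits r sch φ T` and `AdmissibleCubeDecoupling r (subseq sch φ hφ)` give reflection positivity of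
`planeSum T` in every diagonal frame — the socket above fed to the landed transfer `diagRPOfPlaneLimits_of_swapPairingLiminf` (p827255; its verbatim
socket binder IS `OddTorusSwapPairingLiminf r (subseq sch φ hφ)`, `oddTorusSwapPairingLiminf_iff`). -/
theorem diagRPOfPlaneLimits_of_cubeDecoupling
    (T : (n : ℕ) → (Fin n → Plane) → (𝓢((Fin n → EuclideanSpace ℝ (Fin 4)), ℂ) →L[ℂ] ℂ))
    (hw : sch.HasWeakCouplingLimit) (hU : UniformFunctionalBoundPlanes r sch) (hPL : PlaneLimits r sch φ T)
    (hdec : AdmissibleCubeDecoupling r (subseq sch φ hφ)) : DiagonalFrameRP (planeSum T) :=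
  diagRPOfPlaneLimits_of_swapPairingLiminf G r sch φ hφ T hU hPL
    ((oddTorusSwapPairingLiminf_iff r _).1 (oddTorusSwapPairingLiminf_subseq_of_cubeDecoupling r sch φ hφ hw hdec))

end DoorC

/-- **D1′ (`stub_oddTorusSwapPairingLiminf`, skeleton v2) modulo door C's letter** — D1′'s EXACT binder list (`HasWeakCouplingLimit`, `PolyVolume`,
`PolyRenorm`, `UniformFunctionalBoundPlanes`, `RPSpectral`, `PlaneLimits`; all but the first are carried, unused by door C's glue) followed by ONE
hypothesis `AdmissibleCubeDecoupling r (subseq sch φ hφ)` implies D1′'s conclusion `OddTorusSwapPairingLiminf r (subseq sch φ hφ)` BY NAME.  The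
door-C composition for D1′ (twin of the door-B `stub_oddTorusSwapPairingLiminf_of_twistLetters`, p827816); it does NOT close D1′ (the letter is
unproved at weak coupling for non-abelian `G`). -/
theorem stub_oddTorusSwapPairingLiminf_of_cubeDecoupling :
    ∀ (G : Type) [Group G] [TopologicalSpace G] [IsTopologicalGroup G] [CompactSpace G]
      [MeasurableSpace G] [BorelSpace G] (r : LatticeRep G) (sch : SpeciesScheme (YMSpecies G))
      (φ : ℕ → ℕ) (hφ : StrictMono φ)
      (T : (n : ℕ) → (Fin n → Plane) → (𝓢((Fin n → EuclideanSpace ℝ (Fin 4)), ℂ) →L[ℂ] ℂ)),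
      sch.HasWeakCouplingLimit → PolyVolume sch → PolyRenorm r sch → UniformFunctionalBoundPlanes r sch →
        (∃ Δ C : ℝ, 0 < Δ ∧ RPSpectral r sch Δ C) → PlaneLimits r sch φ T →
        AdmissibleCubeDecoupling r (subseq sch φ hφ) → OddTorusSwapPairingLiminf r (subseq sch φ hφ) := by
  intro G _ _ _ _ _ _ r sch φ hφ T hw _ _ _ _ _ hdec
  exact oddTorusSwapPairingLiminf_subseq_of_cubeDecoupling r sch φ hφ hw hdec

/-- **D1 (v1 `stub_diagRPOfPlaneLimits`, now the skeleton's theorem `diagRPOfPlaneLimits_of_stubs`) modulo door C's letter** — D1's EXACT binder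
list followed by `AdmissibleCubeDecoupling r (subseq sch φ hφ)` implies `DiagonalFrameRP (planeSum T)`. -/
theorem stub_diagRPOfPlaneLimits_of_cubeDecoupling :
    ∀ (G : Type) [Group G] [TopologicalSpace G] [IsTopologicalGroup G] [CompactSpace G]
      [MeasurableSpace G] [BorelSpace G] (r : LatticeRep G) (sch : SpeciesScheme (YMSpecies G))
      (φ : ℕ → ℕ) (hφ : StrictMono φ)
      (T : (n : ℕ) → (Fin n → Plane) → (𝓢((Fin n → EuclideanSpace ℝ (Fin 4)), ℂ) →L[ℂ] ℂ)),
      sch.HasWeakCouplingLimit → PolyVolume sch → PolyRenorm r sch → UniformFunctionalBoundPlanes r sch →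
        (∃ Δ C : ℝ, 0 < Δ ∧ RPSpectral r sch Δ C) → PlaneLimits r sch φ T →
        AdmissibleCubeDecoupling r (subseq sch φ hφ) → DiagonalFrameRP (planeSum T) := by
  intro G _ _ _ _ _ _ r sch φ hφ T hw _ _ hU _ hPL hdec
  exact diagRPOfPlaneLimits_of_cubeDecoupling r sch φ hφ T hw hU hPL hdec

end Summit.QuantumFields.YangMills.Theorems.WeakCouplingHypercubicLimit.TraceNormColdPressure

end
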